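import Summits.ResolutionOfSingularities.ResolutionOfSingularities.Theorems.DeltaCutSurfTransport
import Summits.ResolutionOfSingularities.ResolutionOfSingularities.Theorems.MarkedIdealsSolidCentreTransform
import HarnessLib

/-!
# Column transport and the F-solid stage of a base datum (decomp-res lens 6, g30; 0-weight TOOLS, rows 222a/222c/222d/222e)

Round-independent bookkeeping for maximal-centre runs on base `n`-data `(Y, g, M)` (`IsBase`, `IsDatum n`) over a field:

* `SurfCutDatum k` — a triple `(Y, g, M)`; `SurfCutDatum.solidCentre` / `SurfCutDatum.solidStage` — the ideal of the
  (closure of the) SOLID PART of the support and its chosen blow-up (`Theorems/MarkedIdealsSolidSplit`,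
  `…SolidCentre`, `…SolidCentreTransform`);
* `IsColumnTransport g M σ g₁ M₁ e` — the data-tracking form of «`(Y₁, g₁, M₁)` is obtained from `(Y, g, M)` by CHOSEN
  blow-ups `blowup.π C` of weakly permissible centres (`V(C)` regular, `V(C) ⊆ supp`), controlled transforms, `σ`
  factoring through them up to the recorded isomorphism `e`»; `IsColumnTransport.facts` (base datum, `IsDatum n`,
  support = preimage of the support minus what the centres removed … as recorded), and
  `exists_columnTransport_of_isBPermissibleSequenceB` — every Cossart–Jannsen–Saito `𝓑`-permissible sequence over a
  closed subset of the support IS a column transport (the data-tracking form of `exists_stage_of_isBPermissibleSequenceB`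
  of `Theorems/DeltaCutSurfTransport`);
* `SurfCutDatum.solidStage_facts` — the F-solid stage of a base `n`-datum with `1 ≤ n` is a base `n`-datum, spliced to
  the column, with CLOSED support of dimension `≤ 2`.

NEGATIVE KNOWLEDGE (critic note cn37, CRITIC-LEDGER rows 222f–222h, conceded 2026-08-31): the g30 «SurfCut» ROUND built
on these tools — CJS embedded resolution of the REDUCED top locus with boundary reset to `∅`, then the blow-up of its
strict transform — admits an infinite chain of legal rounds from `(𝔸⁴, (x², z⁶w⁶), 2)` in every characteristic (the
forced blow-up inside the crossing line bears a newborn top component in the exceptional divisor whose exponent outgrows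
the round-end drops), so the recurrence bounds typed over that round are FALSE and are NOT in this file; a repaired
round must choose centres for the PAIR (marked ideal, accumulated boundary). This file keeps only the round-independent
tools. No sorry.
-/

noncomputable section

open CategoryTheory CategoryTheory.Limits AlgebraicGeometry TopologicalSpace Topology Order IsLocalRing
open Literature.AlgebraicGeometry.Resolution

namespace Summit.ResolutionOfSingularities.ResolutionOfSingularities.Theorems.DeltaCutClasses

open Summit.ResolutionOfSingularities.ResolutionOfSingularities.Theorems
open WeakOrderReduction ForcedTowerClasses
open Scheme.IdealSheafData (vanishingIdeal)

section SurfColumn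

variable {k : Type} [Field k]

/-- A triple `(Y, g, M)`: ambient scheme over `k` with a marked ideal (the base-`n`-datum conditions `IsBase`,
`IsDatum` are carried by the round, not by the triple). DEFINITION (support). -/
structure SurfCutDatum (k : Type) [Field k] where
  /-- the ambient scheme -/
  Y : Scheme.{0}
  /-- its structure morphism -/
  g : Y ⟶ Spec (.of k)
  /-- the marked ideal -/
  M : MarkedIdeal Y

namespace SurfCutDatum

/-- the F-solid centre: the ideal of the (closure of the) solid part of the support. DEFINITION (support). -/
def solidCentre (D : SurfCutDatum k) : D.Y.IdealSheafData :=
  vanishingIdeal ⟨closure D.M.solidPart, isClosed_closure⟩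

/-- the F-solid stage `(Y₁, g₁, M₁)`: the chosen blow-up of the solid centre. DEFINITION (support). -/
def solidStage (D : SurfCutDatum k) : SurfCutDatum k :=
  ⟨blowup D.solidCentre, blowup.π D.solidCentre ≫ D.g, D.M.transform (blowup.π D.solidCentre) D.solidCentre⟩

end SurfCutDatum

/-- **`IsColumnTransport g M σ g₁ M₁ e` — the base datum `(Y₁, g₁, M₁)` IS THE COLUMN'S TRANSFORM of `(Y, g, M)`
along `σ : Z′ ⟶ Y`, through the isomorphism `e : Z′ ≅ Y₁`:** built from `(Y, g, M, 𝟙)` by CHOSEN blow-ups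
`blowup.π C` of WEAKLY PERMISSIBLE centres (`V(C)` regular, `V(C) ⊆ supp`), marked ideals transformed by controlled
transforms, `σ` factoring through the chosen blow-ups up to the recorded isomorphisms. DEFINITION (support). -/
inductive IsColumnTransport {Y : Scheme.{0}} (g : Y ⟶ Spec (.of k)) (M : MarkedIdeal Y) :
    ∀ ⦃Z' : Scheme.{0}⦄, (Z' ⟶ Y) → ∀ ⦃Y₁ : Scheme.{0}⦄, (Y₁ ⟶ Spec (.of k)) → MarkedIdeal Y₁ → (Z' ≅ Y₁) → Prop
  /-- no blow-up yet -/
  | refl : IsColumnTransport g M (𝟙 Y) g M (Iso.refl Y)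
  /-- one more chosen blow-up of a weakly permissible centre `C` of the current stage, `τ` identified with it by `e₂` -/
  | blowup ⦃Z' Z'' : Scheme.{0}⦄ {σ : Z' ⟶ Y} ⦃Y₁ : Scheme.{0}⦄ {g₁ : Y₁ ⟶ Spec (.of k)} {M₁ : MarkedIdeal Y₁}
      {e : Z' ≅ Y₁} (h : IsColumnTransport g M σ g₁ M₁ e) (C : Y₁.IdealSheafData)
      (hreg : Scheme.IsRegular C.subscheme) (hsub : (C.support : Set Y₁) ⊆ M₁.support) (τ : Z'' ⟶ Z')
      (e₂ : Z'' ≅ blowup C) (he₂ : e₂.hom ≫ blowup.π C = τ ≫ e.hom) :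
      IsColumnTransport g M (τ ≫ σ) (blowup.π C ≫ g₁) (M₁.transform (blowup.π C) C) e₂

/-! ##### The column transport: facts and realisation -/

/-- **a column transport of a base `n`-datum is a base `n`-datum over the same base, and weak resolutions splice
down along it** (induction; each step is `blowup_facts`). [new] [folklore] -/
theorem IsColumnTransport.facts {Y : Scheme.{0}} {g : Y ⟶ Spec (.of k)} (hB : IsBase Y g) {n : ℕ} {M : MarkedIdeal Y}
    (hM : IsDatum n M) {Z' : Scheme.{0}} {σ : Z' ⟶ Y} {Y₁ : Scheme.{0}} {g₁ : Y₁ ⟶ Spec (.of k)} {M₁ : MarkedIdeal Y₁}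
    {e : Z' ≅ Y₁} (h : IsColumnTransport g M σ g₁ M₁ e) :
    IsBase Y₁ g₁ ∧ IsDatum n M₁ ∧ e.hom ≫ g₁ = σ ≫ g ∧
      ((∃ t₁ : CentreSeq Y₁, WeakResolution t₁ M₁) → ∃ t : CentreSeq Y, WeakResolution t M) := by
  induction h with
  | refl => exact ⟨hB, hM, by simp, id⟩
  | @blowup Z' Z'' σ Y₁ g₁ M₁ e h C hreg hsub τ e₂ he₂ ih =>
    obtain ⟨hB₁, hM₁, hg₁, hspl⟩ := ih
    obtain ⟨hB₂, hM₂, -, hspl₂⟩ := blowup_facts hB₁ hM₁ C hreg hsub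
    refine ⟨hB₂, hM₂, ?_, fun hres => hspl (hspl₂ hres)⟩
    rw [← Category.assoc, he₂, Category.assoc, hg₁, Category.assoc]

/-- **REALISATION OF A CJS `𝓑`-PERMISSIBLE TOWER AS A COLUMN TRANSPORT** (the data-tracking form of
`exists_stage_of_isBPermissibleSequenceB`): along any `IsBPermissibleSequenceB X B σ X′ B′` over a base `n`-datum with
`closure X ⊆ supp M` there is a column transport `(Y₁, g₁, M₁, e)` along `σ` with `closure X′ ⊆ e⁻¹ supp M₁`.
[new] [folklore] -/
theorem exists_columnTransport_of_isBPermissibleSequenceB {Y : Scheme.{0}} {g : Y ⟶ Spec (.of k)} (hB : IsBase Y g)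
    {n : ℕ} {M : MarkedIdeal Y} (hM : IsDatum n M) {X B : Set Y} (hX : closure X ⊆ M.support) {Z' : Scheme.{0}}
    {σ : Z' ⟶ Y} {X' B' : Set Z'} (h : IsBPermissibleSequenceB X B σ X' B') :
    ∃ (Y₁ : Scheme.{0}) (g₁ : Y₁ ⟶ Spec (.of k)) (M₁ : MarkedIdeal Y₁) (e : Z' ≅ Y₁),
      IsColumnTransport g M σ g₁ M₁ e ∧ closure X' ⊆ e.hom.base ⁻¹' M₁.support := by
  induction h with
  | refl =>
    refine ⟨Y, g, M, Iso.refl Y, IsColumnTransport.refl, fun y hy => ?_⟩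
    simpa using hX hy
  | @blowup Z' Z'' σ X' B' h C τ hτ hreg hsub hsing hperm hnc ih =>
    obtain ⟨Y₁, g₁, M₁, e, hcol, hX₁⟩ := ih
    obtain ⟨hB₁, hM₁, hg₁, -⟩ := hcol.facts hB hM
    haveI := isLocallyNoetherian_of_isBase hB₁
    haveI : IsLocallyNoetherian Z' := LocallyOfFiniteType.isLocallyNoetherian e.hom
    have hC₁reg : Scheme.IsRegular (C.comap e.inv).subscheme := (isRegular_subscheme_comap_iff_of_isIso e.inv C).mpr hreg
    have hC₁sub : ((C.comap e.inv).support : Set Y₁) ⊆ M₁.support := by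
      intro y hy
      rw [Scheme.IdealSheafData.support_comap] at hy
      have hy' : e.inv.base y ∈ closure X' :=
        Summit.ResolutionOfSingularities.ResolutionOfSingularities.Theorems.TrackC.support_subset_closure_of_le hsub hy
      have h2 : e.hom.base (e.inv.base y) ∈ M₁.support := hX₁ hy'
      rwa [Scheme.inv_hom_apply] at h2
    obtain ⟨hB₂, hM₂, -, -⟩ := blowup_facts hB₁ hM₁ (C.comap e.inv) hC₁reg hC₁sub
    have hτ' : IsBlowup (τ ≫ e.hom) (C.comap e.inv) := hτ.comp_iso e
    obtain ⟨e₂, he₂, -⟩ := hτ'.unique (blowup.isBlowup (C.comap e.inv))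
    refine ⟨blowup (C.comap e.inv), blowup.π (C.comap e.inv) ≫ g₁,
      M₁.transform (blowup.π (C.comap e.inv)) (C.comap e.inv), e₂, hcol.blowup (C.comap e.inv) hC₁reg hC₁sub τ e₂ he₂, ?_⟩
    haveI := isLocallyNoetherian_of_isBase hB₂
    rw [closure_closure]
    refine closure_minimal (fun z hz => ?_) ((isClosed_support_of_isBase hB₂ _).preimage e₂.hom.continuous)
    obtain ⟨hzX, hzC⟩ := hz
    have hπy : (blowup.π (C.comap e.inv)).base (e₂.hom.base z) = e.hom.base (τ.base z) := by
      rw [← Scheme.Hom.comp_apply, he₂, Scheme.Hom.comp_apply]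
    have hnot : (blowup.π (C.comap e.inv)).base (e₂.hom.base z) ∉ ((C.comap e.inv).support : Set Y₁) := by
      rw [hπy, Scheme.IdealSheafData.support_comap]
      intro hmem
      apply hzC
      have h3 : e.inv.base (e.hom.base (τ.base z)) ∈ (C.support : Set Z') := hmem
      rwa [Scheme.hom_inv_apply] at h3
    have hin : e.hom.base (τ.base z) ∈ M₁.support := hX₁ (subset_closure hzX)
    show ((M₁.transform _ _).mult : ℕ∞) ≤ idealOrder (M₁.transform _ _).ideal (e₂.hom.base z)
    rw [MarkedIdeal.transform_mult, MarkedIdeal.transform_ideal, hM₁.1,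
      (blowup.isBlowup _).idealOrder_controlledTransform_of_not_mem M₁.ideal n hnot, hπy,
      idealOrder_eq_of_mem_support hM₁ hin]

/-! ##### The F-solid stage of a base datum -/

namespace SurfCutDatum

variable {n : ℕ} (D : SurfCutDatum k)

/-- `1 ≤ μ` for a base `n`-datum with `1 ≤ n`. [folklore] -/
theorem one_le_mult (hM : IsDatum n D.M) (hn : 1 ≤ n) : 1 ≤ D.M.mult := by rw [hM.1]; exact hn

/-- `ord ≤ μ` everywhere for a base `n`-datum. [folklore] -/
theorem idealOrder_le_mult (hM : IsDatum n D.M) (y : D.Y) : idealOrder D.M.ideal y ≤ (D.M.mult : ℕ∞) := by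
  rw [hM.1]; exact hM.2 y

/-- on a base datum the underlying space is Noetherian. [folklore] -/
theorem noetherianSpace (hB : IsBase D.Y D.g) : NoetherianSpace D.Y := by
  haveI := hB.locallyOfFiniteType
  haveI := hB.quasiCompact
  haveI : IsNoetherian D.Y := Scheme.isNoetherian_of_finiteType_over_field D.g
  infer_instance

/-- the solid centre IS the ideal of the (closed) solid part. [folklore] -/
theorem solidCentre_eq (hB : IsBase D.Y D.g) (hM : IsDatum n D.M) (hn : 1 ≤ n) :
    D.solidCentre = vanishingIdeal ⟨D.M.solidPart, by
      haveI := D.noetherianSpace hB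
      exact MarkedIdeal.isClosed_solidPart hB.isRegular (D.one_le_mult hM hn) (D.idealOrder_le_mult hM)
        (isClosed_support_of_isBase hB D.M)⟩ := by
  haveI := D.noetherianSpace hB
  have hcl : IsClosed D.M.solidPart := MarkedIdeal.isClosed_solidPart hB.isRegular (D.one_le_mult hM hn)
    (D.idealOrder_le_mult hM) (isClosed_support_of_isBase hB D.M)
  unfold solidCentre
  congr 1
  exact TopologicalSpace.Closeds.ext hcl.closure_eq

/-- **the F-solid centre is WEAKLY PERMISSIBLE, I: regular.** [new] [folklore] -/
theorem isRegular_subscheme_solidCentre (hB : IsBase D.Y D.g) (hM : IsDatum n D.M) (hn : 1 ≤ n) :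
    Scheme.IsRegular D.solidCentre.subscheme := by
  haveI := D.noetherianSpace hB
  haveI := isLocallyNoetherian_of_isBase hB
  rw [D.solidCentre_eq hB hM hn]
  exact MarkedIdeal.isRegular_subscheme_vanishingIdeal_solidPart hB.isRegular (D.one_le_mult hM hn)
    (D.idealOrder_le_mult hM) (isClosed_support_of_isBase hB D.M)

/-- **the F-solid centre is WEAKLY PERMISSIBLE, II: inside the support.** [new] [folklore] -/
theorem support_solidCentre_subset (hB : IsBase D.Y D.g) (hM : IsDatum n D.M) (hn : 1 ≤ n) :
    (D.solidCentre.support : Set D.Y) ⊆ D.M.support := by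
  haveI := D.noetherianSpace hB
  rw [D.solidCentre_eq hB hM hn]
  exact MarkedIdeal.support_vanishingIdeal_solidPart_subset hB.isRegular (D.one_le_mult hM hn)
    (D.idealOrder_le_mult hM) (isClosed_support_of_isBase hB D.M)

/-- **THE F-solid STAGE**: a base `n`-datum whose weak resolutions splice down, with CLOSED support of dimension `≤ 2`.
[new] [folklore] -/
theorem solidStage_facts (hB : IsBase D.Y D.g) (hM : IsDatum n D.M) (hn : 1 ≤ n) :
    IsBase D.solidStage.Y D.solidStage.g ∧ IsDatum n D.solidStage.M ∧
      ((∃ t₁ : CentreSeq D.solidStage.Y, WeakResolution t₁ D.solidStage.M) →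
        ∃ t : CentreSeq D.Y, WeakResolution t D.M) ∧
      IsClosed D.solidStage.M.support ∧ topologicalKrullDim D.solidStage.M.support ≤ 2 := by
  obtain ⟨hB₁, hM₁, -, hspl⟩ := blowup_facts hB hM D.solidCentre (D.isRegular_subscheme_solidCentre hB hM hn)
    (D.support_solidCentre_subset hB hM hn)
  refine ⟨hB₁, hM₁, hspl, isClosed_support_of_isBase hB₁ _, ?_⟩
  haveI := D.noetherianSpace hB
  haveI := isLocallyNoetherian_of_isBase hB
  have h42 : ((4 - 2 : ℕ) : WithBot ℕ∞) = 2 := by norm_num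
  rw [← h42]
  show topologicalKrullDim (D.M.transform (blowup.π D.solidCentre) D.solidCentre).support ≤ _
  have hτ : IsBlowup (blowup.π D.solidCentre) (vanishingIdeal ⟨D.M.solidPart, _⟩) :=
    (congrArg (IsBlowup (blowup.π D.solidCentre)) (D.solidCentre_eq hB hM hn)).mp (blowup.isBlowup D.solidCentre)
  have key := MarkedIdeal.topologicalKrullDim_support_transform_vanishingIdeal_solidPart_le hB.isRegular
    (D.one_le_mult hM hn) (D.idealOrder_le_mult hM) (isClosed_support_of_isBase hB D.M) hB.dim_le hτ
  rw [← D.solidCentre_eq hB hM hn] at key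
  exact key

end SurfCutDatum

end SurfColumn

end Summit.ResolutionOfSingularities.ResolutionOfSingularities.Theorems.DeltaCutClasses

end
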